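/-
Copyright (c) 2026 the pub-hodgecm-mathlib formalisation cell (harness21).  Prover seat hodgecm-mathlib-K2Liu-p23 (g2), Track B «K2-LIT»,
#184♮ = hLiu418 = `stmt-HodgeConjecture-24832`; #42S organ S1, (M2a) inert middle-row chain, brick (C3-b) «THE LEVI DISCHARGE `∃ B, hB`»
(K2Liu-p26 (g2) (C3) HEAD BYTES 2026-09-04T22:15:07Z; LEAD F0P6-plan (g14) BATCH #65 (3) ∕ RULING M-158h (f)).  KERNEL: theorems only.
-/
import Summits.HodgeConjecture.HodgeConjecture.Theorems.K2LiuA7ValueInstanceDefs        -- ★ `leviDeltaLoc`; brings ★ `K2LiuA7ValuePartnerBlocks` (`blkB∕blkC_matA_tensorEmbLoc_eq_zero`), ★ `K2LiuSiegelLeviWeylAlgebra`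
import Literature.NumberTheory.GelbartRogawski1991.LocalDoubledWeylElementCayleyMover    -- ★ the Cayley rows' shape `exists_mover_conj_iotaD_weylDelta`, ★ `weylDelta_mul_self`
import Literature.RepresentationTheory.HeisenbergGroup.SymplecticMatrixTransport         -- ★ `transportSp`, `transportSp_levi`, `transportSp_J`
import HarnessLib

/-!
# Crux `HLiu418`, #42S organ S1, (M2a) chain, brick (C3-b): AN ELEMENT OF `Sp(𝕎)` FIXING THE TWO LAGRANGIANS `X × 0` AND `0 × Y` IS A
# TRANSPORTED SIEGEL LEVI ELEMENT `m(B)` — and the discharge `∃ B, E′ · ι^𝔻(k ⊗ 1) · E′⁻¹ = transportSp 𝕋 (m(B))` for `k ∈ M_Δ`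

Cell `hodgecm-mathlib`, crux item hLiu418 = `stmt-HodgeConjecture-24832`, route of record `HCCMUnconditional`; squad K2 ∕ K2Liu, road `K2_Liu`,
socket #42S (a), organ S1; LEAD F0P6-plan (g14); (M2a) chain lead K2Liu-p01 (g10), (C3) head K2Liu-p26 (g2).  THEOREMS ONLY (no `def`, no
`instance`, no `notation`, no named-fact hypothesis, no `sorry`); lane `--supports stmt-HodgeConjecture-24832 --as helper` (count-neutral helper).

WHY.  The (C3) Levi row of the middle-cell factorisation (K2Liu-p26 (g2), `K2LiuTensorMiddleCellLeviRow.exists_ne_zero_swSectionTensorLoc_flip_mul_nElem_mul_eq_integral_levi`)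
reads the section `F_Ψ(w₁ · n(t) · k)` for a Siegel-Levi element `k` through Kudla's block implementer `E′ = π(frameMp_{PD} j̃(p₁, p₂))`, and asks
BY VALUE for a pair `(B, hB)`: `hB : E′ · ι^𝔻(k ⊗ 1) · E′⁻¹ = transportSp 𝕋 (m(B))` — the conjugate of the embedded unitary Levi element by the mover is
a Siegel LEVI element `m(B) = diag(B, B⁻ᵀ)` of `Sp(𝕎)` in the `X ∕ Y` frame (then ★ (C3-a) `K2LiuBlockImplementerLeviAction` turns `ω` of it into
`|det B|^{-1∕2} Φ(B⁻¹ ·)`).  THIS FILE discharges `∃ B, hB` from the two rows the mover satisfies in (C2c)'s own Cayley currency (★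
`exists_mover_conj_iotaD_weylDelta` prints exactly these two shapes): `E′ ℓ_Δ = ℓ_Y` and `E′ · ι^𝔻(w_Δ) · E′⁻¹ = J_𝕋⁻¹ · m(B_W)`.

* §1 (pure symplectic linear algebra over a commutative ring `K`, Gram matrix `T` with unit determinant; base ★ `SymplecticMatrixTransport`):
  **`exists_eq_transportSp_levi_of_apply`** — an element `g ∈ Sp(W, β_T)`, `W = K^ι × K^ι`, with `g(X × 0) ⊆ X × 0` and `g(0 × Y) ⊆ 0 × Y` IS
  `transportSp T (m(B))` for some `B ∈ GL_ι(K)` (its diagonal blocks `a, d` satisfy `β_T(a x, d y) = β_T(x, y)`, i.e. `Aᵀ T D = T`, so `det A` is a unit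
  and `D = T⁻¹ A⁻ᵀ T`); the `Submodule.map` form `exists_eq_transportSp_levi_of_map_le`; the value `coe_transportSp_levi_apply`
  (`transportSp T (m(B)) (x, y) = (B x, T⁻¹ B⁻ᵀ T y)`, for the frame reading (C3-c)); and the two Lagrangian rows of the generators
  `map_transportSp_levi_prod_bot_top` (`m(B)` fixes `0 × Y`), `map_transportSp_symJ_prod_top_bot` (`J_𝕋 (X × 0) = 0 × Y`),
  `map_transportSp_symJ_inv_prod_bot_top` (`J_𝕋⁻¹ (0 × Y) = X × 0`).
* §2 (GR91 doubled unitary currency `H(F_v) = U(T₀ ⊕ −T₀)(F_v)`, `ι^𝔻_v`, `ℓ_Δ`, `ℓ_Y`, `w_Δ`; the opposite Lagrangian `ℓ_∇ = Res Δ⁻` is SPELLED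
  `ι^𝔻(w_Δ) ℓ_Δ` — `w_Δ` swaps `Δ` and `Δ⁻` —, no new definition):
  `map_map_iotaD_weylDelta_deltaLagrangian` (`B(h) = C(h) = 0 ⇒ ι^𝔻(h)` fixes `ι^𝔻(w_Δ) ℓ_Δ`, by ★ `isSiegelDelta_weylDelta_conj` and `w_Δ² = 1`);
  `map_map_iotaD_weylDelta_deltaLagrangian_eq_prod` (the X-ROW DERIVED from the two Cayley rows: `E′ (ι^𝔻(w_Δ) ℓ_Δ) = J_𝕋⁻¹ m(B_W) ℓ_Y = X × 0`);
  **`exists_conj_iotaD_eq_transportSp_levi`**: for `h` with `B(h) = C(h) = 0` and a mover `E′` with the two Cayley rows,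
  `∃ B, E′ · ι^𝔻(h) · E′⁻¹ = transportSp 𝕋 (m(B))`.
* §3 (K2Lit tensor currency, K2Liu-p26's `hB` letters verbatim): **`exists_conj_iotaD_tensorEmbLoc_eq_transportSp_levi`** — the same at
  `h := k ⊗ 1 = tensorEmbLoc v k` for `k ∈ M_Δ = leviDeltaLoc` of the SMALL doubled group (★ `blkB∕blkC_matA_tensorEmbLoc_eq_zero`).

DEGENERATE-INSTANCE LINE (σ23).  At `k = 1` the conclusion holds with `B = 1` (`E′ · 1 · E′⁻¹ = 1 = m(1)`); the `∃ B` ranges over `GL`, the witness is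
pinned by ★ `transportSp_injective` and `coe_transportSp_levi_apply`; every hypothesis is about the explicit `E′`, `k` handed in — not vacuous.
NOT here: the construction of `E′` and its two rows ((C2c), K2Liu-p01), the Levi row itself ((C3), K2Liu-p26), the frame reading ((C3-c)).
References: [Kudla1994] §2 (the polarisation `𝕎 = Δ + ∇`), §3 Thm. 3.1; [HarrisKudlaSweet1996] §1 (1.11), (1.15); [Weil1964] n° 6, n° 32;
[MoeglinVignerasWaldspurger1987] Chap. 2 II.2, II.6.
HONEST LABEL.  Count-neutral helper; it retires nothing by itself: `HC_CM` is proved only modulo the 7 printed citations (2 remaining named inputs: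
hLiu418 = `stmt-HodgeConjecture-24832`, h413 = `stmt-HodgeConjecture-24833`) until rung 0 closes.

## References
* [Kudla1994] S. S. Kudla, *Splitting metaplectic covers of dual reductive pairs*, Israel J. Math. 87 (1994) 361–401, §2–§3.
* [HarrisKudlaSweet1996] M. Harris, S. Kudla, W. J. Sweet, J. Amer. Math. Soc. 9 (1996) 941–1004, §1 (1.11), (1.15).
* [Weil1964] A. Weil, *Sur certains groupes d'opérateurs unitaires*, Acta Math. 111 (1964) 143–211, n° 6, n° 32.
* [MoeglinVignerasWaldspurger1987] C. Mœglin, M.-F. Vignéras, J.-L. Waldspurger, LNM 1291 (1987), Chap. 2 II.2, II.6.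
-/

set_option autoImplicit false
set_option linter.dupNamespace false -- the mandated namespace repeats `HodgeConjecture.HodgeConjecture`

noncomputable section

open scoped Matrix
open NumberField IsDedekindDomain Matrix
open Literature.RepresentationTheory.HeisenbergGroup Literature.RepresentationTheory.HeisenbergGroup.SymplecticMatrix
open Literature.NumberTheory.Automorphic Literature.NumberTheory.Automorphic.UnitaryGroup
open Literature.NumberTheory.GelbartRogawski1991 Literature.NumberTheory.GelbartRogawski1991.AdaptedBlocks
open Literature.NumberTheory.GelbartRogawski1991.UnitaryDualPair
open Literature.NumberTheory.GelbartRogawski1991.UnitaryDualPair.LocalSplitting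
open Summit.HodgeConjecture.HodgeConjecture.Cruxes.HLiu418.K2LiuSiegelLeviWeylAlgebra (isSiegelDelta_weylDelta_conj)

namespace Summit.HodgeConjecture.HodgeConjecture.Cruxes.HLiu418.K2LiuSymplecticLeviOfFixedLagrangians

/-! ## §1 An element of `Sp(W, β_T)` fixing `X × 0` and `0 × Y` is a transported Siegel Levi element -/

section Symplectic

variable {K : Type*} [CommRing K] {ι : Type*} [Fintype ι] [DecidableEq ι] (T : Matrix ι ι K) (hT : IsUnit T.det)

/-- **the value of the transported Levi element**: `transportSp T (m(B)) (x, y) = (B x, T⁻¹ B⁻ᵀ T y)` (★ `transportSp_levi` read on vectors).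
[cite: Weil1964, n° 6, p. 151] [cite: MoeglinVignerasWaldspurger1987, Chap. 2 II.2] -/
theorem coe_transportSp_levi_apply (B : GL ι K) (w : (ι → K) × (ι → K)) :
    ((transportSp T hT (levi B) : symplecticGroup (polar (Matrix.toLinearMap₂' K T))) :
        ((ι → K) × (ι → K)) ≃ₗ[K] ((ι → K) × (ι → K))) w =
      ((B : Matrix ι ι K) *ᵥ w.1, (T⁻¹ * ((B⁻¹ : GL ι K) : Matrix ι ι K)ᵀ * T) *ᵥ w.2) := by
  rw [transportSp_levi, coe_leviSp_apply, glEquiv_apply, leviDual_apply]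

/-- **AN ELEMENT OF `Sp(W, β_T)` STABILISING `X × 0` AND `0 × Y` IS `m(B)`** (pointwise form): if `g ∈ Sp(W)`, `W = K^ι × K^ι` with the alternating
form of `polar β_T`, satisfies `(g(x, 0))₂ = 0` and `(g(0, y))₁ = 0` for all `x, y`, then `g = transportSp T (m(B))` for some `B ∈ GL_ι(K)` — its
diagonal blocks `a, d` satisfy `β_T(a x, d y) = β_T(x, y)`, i.e. `Aᵀ T D = T`, so `det A` is a unit and `D = T⁻¹ A⁻ᵀ T`.
[cite: Weil1964, n° 6, p. 151] [cite: MoeglinVignerasWaldspurger1987, Chap. 2 II.2] -/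
theorem exists_eq_transportSp_levi_of_apply (g : symplecticGroup (polar (Matrix.toLinearMap₂' K T)))
    (hX : ∀ x : ι → K, (((g : symplecticGroup (polar (Matrix.toLinearMap₂' K T))) :
        ((ι → K) × (ι → K)) ≃ₗ[K] ((ι → K) × (ι → K))) (x, 0)).2 = 0)
    (hY : ∀ y : ι → K, (((g : symplecticGroup (polar (Matrix.toLinearMap₂' K T))) :
        ((ι → K) × (ι → K)) ≃ₗ[K] ((ι → K) × (ι → K))) (0, y)).1 = 0) :
    ∃ B : GL ι K, g = transportSp T hT (levi B) := by
  classical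
  -- the diagonal blocks of `g`
  set A : Matrix ι ι K := LinearMap.toMatrix' ((LinearMap.fst K (ι → K) (ι → K)) ∘ₗ
    ((g : symplecticGroup (polar (Matrix.toLinearMap₂' K T))) : ((ι → K) × (ι → K)) ≃ₗ[K] ((ι → K) × (ι → K))).toLinearMap ∘ₗ
      LinearMap.inl K (ι → K) (ι → K)) with hA
  set D : Matrix ι ι K := LinearMap.toMatrix' ((LinearMap.snd K (ι → K) (ι → K)) ∘ₗ
    ((g : symplecticGroup (polar (Matrix.toLinearMap₂' K T))) : ((ι → K) × (ι → K)) ≃ₗ[K] ((ι → K) × (ι → K))).toLinearMap ∘ₗ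
      LinearMap.inr K (ι → K) (ι → K)) with hD
  have hgx : ∀ x : ι → K, ((g : symplecticGroup (polar (Matrix.toLinearMap₂' K T))) :
      ((ι → K) × (ι → K)) ≃ₗ[K] ((ι → K) × (ι → K))) (x, 0) = (A *ᵥ x, 0) := by
    intro x
    refine Prod.ext ?_ (hX x)
    rw [hA, LinearMap.toMatrix'_mulVec]
    rfl
  have hgy : ∀ y : ι → K, ((g : symplecticGroup (polar (Matrix.toLinearMap₂' K T))) :
      ((ι → K) × (ι → K)) ≃ₗ[K] ((ι → K) × (ι → K))) (0, y) = (0, D *ᵥ y) := by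
    intro y
    refine Prod.ext (hY y) ?_
    rw [hD, LinearMap.toMatrix'_mulVec]
    rfl
  have hg : ∀ w : (ι → K) × (ι → K), ((g : symplecticGroup (polar (Matrix.toLinearMap₂' K T))) :
      ((ι → K) × (ι → K)) ≃ₗ[K] ((ι → K) × (ι → K))) w = (A *ᵥ w.1, D *ᵥ w.2) := by
    intro w
    have hw : w = (w.1, 0) + (0, w.2) := by rw [Prod.mk_add_mk, add_zero, zero_add]
    calc ((g : symplecticGroup (polar (Matrix.toLinearMap₂' K T))) : ((ι → K) × (ι → K)) ≃ₗ[K] ((ι → K) × (ι → K))) w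
        = ((g : symplecticGroup (polar (Matrix.toLinearMap₂' K T))) : ((ι → K) × (ι → K)) ≃ₗ[K] ((ι → K) × (ι → K))) ((w.1, 0) + (0, w.2)) := by
          rw [← hw]
      _ = (A *ᵥ w.1, 0) + (0, D *ᵥ w.2) := by rw [map_add, hgx, hgy]
      _ = (A *ᵥ w.1, D *ᵥ w.2) := by rw [Prod.mk_add_mk, add_zero, zero_add]
  -- `g` is symplectic: `β_T(A x, D y) = β_T(x, y)`
  have hβ : ∀ (x y : ι → K), (A *ᵥ x) ⬝ᵥ (T *ᵥ (D *ᵥ y)) = x ⬝ᵥ (T *ᵥ y) := by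
    intro x y
    have h := (mem_symplecticGroup (polar (Matrix.toLinearMap₂' K T)) _).1 g.2 (x, 0) (0, y)
    rw [hgx, hgy] at h
    simpa only [polar_apply, Matrix.toLinearMap₂'_apply', Matrix.mulVec_zero, dotProduct_zero, sub_zero] using h
  -- hence `Aᵀ T D = T`
  have hATD : Aᵀ * T * D = T := by
    have h2 : (Matrix.toLinearMap₂' K T).compl₁₂ (Matrix.toLin' A) (Matrix.toLin' D) = Matrix.toLinearMap₂' K T := by
      refine LinearMap.ext fun x => LinearMap.ext fun y => ?_
      rw [LinearMap.compl₁₂_apply, Matrix.toLin'_apply, Matrix.toLin'_apply, Matrix.toLinearMap₂'_apply', Matrix.toLinearMap₂'_apply']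
      exact hβ x y
    rw [Matrix.toLinearMap₂'_comp] at h2
    exact (Matrix.toLinearMap₂' K).injective h2
  -- `det A` is a unit
  have hAu : IsUnit A.det := by
    have h := congrArg Matrix.det hATD
    rw [Matrix.det_mul, Matrix.det_mul, Matrix.det_transpose] at h
    refine IsUnit.of_mul_eq_one (T.det * D.det * ↑hT.unit⁻¹) ?_
    rw [← mul_assoc, ← mul_assoc, h, IsUnit.mul_val_inv]
  -- `D = T⁻¹ A⁻ᵀ T`
  have hTD : T * D = (A⁻¹)ᵀ * T := by
    have h2 : (A⁻¹)ᵀ * (Aᵀ * T * D) = (A⁻¹)ᵀ * T := by rw [hATD]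
    rwa [Matrix.mul_assoc Aᵀ, ← Matrix.mul_assoc (A⁻¹)ᵀ, ← Matrix.transpose_mul, Matrix.mul_nonsing_inv A hAu,
      Matrix.transpose_one, Matrix.one_mul] at h2
  have hDeq : D = T⁻¹ * (A⁻¹)ᵀ * T := by
    rw [Matrix.mul_assoc, ← hTD, Matrix.nonsing_inv_mul_cancel_left T D hT]
  -- the witness
  have hAu' : IsUnit A := (Matrix.isUnit_iff_isUnit_det A).2 hAu
  have hBu : ((hAu'.unit : GL ι K) : Matrix ι ι K) = A := hAu'.unit_spec
  have hBuinv : ((hAu'.unit⁻¹ : GL ι K) : Matrix ι ι K) = A⁻¹ := by rw [Matrix.coe_units_inv, hBu]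
  refine ⟨hAu'.unit, Subtype.ext (LinearEquiv.ext fun w => ?_)⟩
  rw [hg, coe_transportSp_levi_apply, hBu, hBuinv, ← hDeq]

/-- **AN ELEMENT OF `Sp(W, β_T)` STABILISING `X × 0` AND `0 × Y` IS `m(B)`** (`Submodule.map` form): `g(X × 0) ≤ X × 0` and `g(0 × Y) ≤ 0 × Y` imply
`g = transportSp T (m(B))` for some `B ∈ GL_ι(K)`. [cite: Weil1964, n° 6, p. 151] [cite: MoeglinVignerasWaldspurger1987, Chap. 2 II.2] -/
theorem exists_eq_transportSp_levi_of_map_le (g : symplecticGroup (polar (Matrix.toLinearMap₂' K T)))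
    (hX : Submodule.map (((g : symplecticGroup (polar (Matrix.toLinearMap₂' K T))) :
        ((ι → K) × (ι → K)) ≃ₗ[K] ((ι → K) × (ι → K))) : ((ι → K) × (ι → K)) →ₗ[K] ((ι → K) × (ι → K)))
        (Submodule.prod ⊤ ⊥) ≤ Submodule.prod ⊤ ⊥)
    (hY : Submodule.map (((g : symplecticGroup (polar (Matrix.toLinearMap₂' K T))) :
        ((ι → K) × (ι → K)) ≃ₗ[K] ((ι → K) × (ι → K))) : ((ι → K) × (ι → K)) →ₗ[K] ((ι → K) × (ι → K)))
        (Submodule.prod ⊥ ⊤) ≤ Submodule.prod ⊥ ⊤) :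
    ∃ B : GL ι K, g = transportSp T hT (levi B) := by
  refine exists_eq_transportSp_levi_of_apply T hT g (fun x => ?_) (fun y => ?_)
  · have h := hX ⟨(x, 0), Submodule.mem_prod.2 ⟨Submodule.mem_top, (Submodule.mem_bot K).2 rfl⟩, rfl⟩
    exact (Submodule.mem_bot K).1 (Submodule.mem_prod.1 h).2
  · have h := hY ⟨(0, y), Submodule.mem_prod.2 ⟨(Submodule.mem_bot K).2 rfl, Submodule.mem_top⟩, rfl⟩
    exact (Submodule.mem_bot K).1 (Submodule.mem_prod.1 h).1

/-- `(g₁ g₂)` acts as `g₁ ∘ g₂`: the underlying linear map of a product in `Sp(W, β_T)` is the composite. [cite: Weil1964, n° 6, p. 151] -/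
theorem coe_mul_eq_comp (g₁ g₂ : symplecticGroup (polar (Matrix.toLinearMap₂' K T))) :
    (((g₁ * g₂ : symplecticGroup (polar (Matrix.toLinearMap₂' K T))) : ((ι → K) × (ι → K)) ≃ₗ[K] ((ι → K) × (ι → K))) :
        ((ι → K) × (ι → K)) →ₗ[K] ((ι → K) × (ι → K))) =
      (((g₁ : symplecticGroup (polar (Matrix.toLinearMap₂' K T))) : ((ι → K) × (ι → K)) ≃ₗ[K] ((ι → K) × (ι → K))) :
          ((ι → K) × (ι → K)) →ₗ[K] ((ι → K) × (ι → K))) ∘ₗ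
        (((g₂ : symplecticGroup (polar (Matrix.toLinearMap₂' K T))) : ((ι → K) × (ι → K)) ≃ₗ[K] ((ι → K) × (ι → K))) :
          ((ι → K) × (ι → K)) →ₗ[K] ((ι → K) × (ι → K))) :=
  LinearMap.ext fun _ => rfl

/-- `g⁻¹ (g w) = w` in `Sp(W, β_T)`. [cite: Weil1964, n° 6, p. 151] -/
theorem coe_inv_apply_coe_apply (g : symplecticGroup (polar (Matrix.toLinearMap₂' K T))) (w : (ι → K) × (ι → K)) :
    ((g⁻¹ : symplecticGroup (polar (Matrix.toLinearMap₂' K T))) : ((ι → K) × (ι → K)) ≃ₗ[K] ((ι → K) × (ι → K)))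
        (((g : symplecticGroup (polar (Matrix.toLinearMap₂' K T))) : ((ι → K) × (ι → K)) ≃ₗ[K] ((ι → K) × (ι → K))) w) = w := by
  rw [← LinearEquiv.mul_apply, ← Subgroup.coe_mul, inv_mul_cancel, Subgroup.coe_one, LinearEquiv.coe_one, id_eq]

/-- `g (g⁻¹ w) = w` in `Sp(W, β_T)`. [cite: Weil1964, n° 6, p. 151] -/
theorem coe_apply_coe_inv_apply (g : symplecticGroup (polar (Matrix.toLinearMap₂' K T))) (w : (ι → K) × (ι → K)) :
    ((g : symplecticGroup (polar (Matrix.toLinearMap₂' K T))) : ((ι → K) × (ι → K)) ≃ₗ[K] ((ι → K) × (ι → K)))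
        (((g⁻¹ : symplecticGroup (polar (Matrix.toLinearMap₂' K T))) : ((ι → K) × (ι → K)) ≃ₗ[K] ((ι → K) × (ι → K))) w) = w := by
  rw [← LinearEquiv.mul_apply, ← Subgroup.coe_mul, mul_inv_cancel, Subgroup.coe_one, LinearEquiv.coe_one, id_eq]

/-- **two-sided mapping ⇒ image**: if `g p ≤ q` and `g⁻¹ q ≤ p` then `p.map g = q`. [folklore] -/
theorem map_eq_of_le_of_inv_le (g : symplecticGroup (polar (Matrix.toLinearMap₂' K T)))
    (p q : Submodule K ((ι → K) × (ι → K)))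
    (h₁ : ∀ w ∈ p, ((g : symplecticGroup (polar (Matrix.toLinearMap₂' K T))) : ((ι → K) × (ι → K)) ≃ₗ[K] ((ι → K) × (ι → K))) w ∈ q)
    (h₂ : ∀ w ∈ q, ((g⁻¹ : symplecticGroup (polar (Matrix.toLinearMap₂' K T))) : ((ι → K) × (ι → K)) ≃ₗ[K] ((ι → K) × (ι → K))) w ∈ p) :
    Submodule.map (((g : symplecticGroup (polar (Matrix.toLinearMap₂' K T))) :
        ((ι → K) × (ι → K)) ≃ₗ[K] ((ι → K) × (ι → K))) : ((ι → K) × (ι → K)) →ₗ[K] ((ι → K) × (ι → K))) p = q := by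
  refine le_antisymm ?_ fun w hw => ?_
  · rintro _ ⟨w, hw, rfl⟩
    exact h₁ w hw
  · exact ⟨_, h₂ w hw, coe_apply_coe_inv_apply T g w⟩

/-- **`m(B)` fixes `0 × Y`**: `transportSp T (m(B)) (0 × Y) = 0 × Y`. [cite: Weil1964, n° 6, p. 151] [cite: MoeglinVignerasWaldspurger1987, Chap. 2 II.2] -/
theorem map_transportSp_levi_prod_bot_top (B : GL ι K) :
    Submodule.map (((transportSp T hT (levi B) : symplecticGroup (polar (Matrix.toLinearMap₂' K T))) :
        ((ι → K) × (ι → K)) ≃ₗ[K] ((ι → K) × (ι → K))) : ((ι → K) × (ι → K)) →ₗ[K] ((ι → K) × (ι → K)))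
        (Submodule.prod ⊥ ⊤) = Submodule.prod ⊥ ⊤ := by
  refine map_eq_of_le_of_inv_le T _ _ _ (fun w hw => ?_) (fun w hw => ?_)
  · have hw1 : w.1 = 0 := (Submodule.mem_bot K).1 (Submodule.mem_prod.1 hw).1
    rw [coe_transportSp_levi_apply, hw1, Matrix.mulVec_zero]
    exact Submodule.mem_prod.2 ⟨(Submodule.mem_bot K).2 rfl, Submodule.mem_top⟩
  · have hw1 : w.1 = 0 := (Submodule.mem_bot K).1 (Submodule.mem_prod.1 hw).1
    have hli : transportSp T hT (levi B⁻¹) = (transportSp T hT (levi B))⁻¹ := by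
      rw [show (levi B⁻¹ : Matrix.symplecticGroup ι K) = (levi B)⁻¹ from map_inv leviHom B, map_inv]
    rw [← hli, coe_transportSp_levi_apply, hw1, Matrix.mulVec_zero]
    exact Submodule.mem_prod.2 ⟨(Submodule.mem_bot K).2 rfl, Submodule.mem_top⟩

/-- **`J_𝕋 (X × 0) = 0 × Y`** (`J_𝕋 (x, y) = (−T y, T⁻¹ x)`). [cite: Weil1964, n° 6, p. 151] [cite: MoeglinVignerasWaldspurger1987, Chap. 2 II.2] -/
theorem map_transportSp_symJ_prod_top_bot :
    Submodule.map (((transportSp T hT (SymplecticGroup.symJ ι K) : symplecticGroup (polar (Matrix.toLinearMap₂' K T))) :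
        ((ι → K) × (ι → K)) ≃ₗ[K] ((ι → K) × (ι → K))) : ((ι → K) × (ι → K)) →ₗ[K] ((ι → K) × (ι → K)))
        (Submodule.prod ⊤ ⊥) = Submodule.prod ⊥ ⊤ := by
  refine map_eq_of_le_of_inv_le T _ _ _ (fun w hw => ?_) (fun w hw => ?_)
  · have hw2 : w.2 = 0 := (Submodule.mem_bot K).1 (Submodule.mem_prod.1 hw).2
    rw [transportSp_J, coe_weylSp, weylσ_apply, weylGamma_apply, hw2, Matrix.mulVec_zero, neg_zero]
    exact Submodule.mem_prod.2 ⟨(Submodule.mem_bot K).2 rfl, Submodule.mem_top⟩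
  · have hw1 : w.1 = 0 := (Submodule.mem_bot K).1 (Submodule.mem_prod.1 hw).1
    -- `J_𝕋⁻¹ w = (T w₂, −T⁻¹ w₁)`: read off `J_𝕋 (J_𝕋⁻¹ w) = w`
    have h := coe_apply_coe_inv_apply T (transportSp T hT (SymplecticGroup.symJ ι K)) w
    set u := (((transportSp T hT (SymplecticGroup.symJ ι K))⁻¹ : symplecticGroup (polar (Matrix.toLinearMap₂' K T))) :
        ((ι → K) × (ι → K)) ≃ₗ[K] ((ι → K) × (ι → K))) w with hu
    rw [transportSp_J, coe_weylSp, weylσ_apply, weylGamma_apply, gramEquiv_symm_apply] at h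
    have h1 := congrArg Prod.fst h
    have h2 := congrArg Prod.snd h
    dsimp only at h1 h2
    have hu2 : u.2 = -(T⁻¹ *ᵥ w.1) := by
      have h3 := congrArg (fun z => T⁻¹ *ᵥ z) h1
      simp only [Matrix.mulVec_neg, Matrix.mulVec_mulVec, Matrix.nonsing_inv_mul T hT, Matrix.one_mulVec] at h3
      rw [← h3, neg_neg]
    rw [Submodule.mem_prod, hu2, hw1, Matrix.mulVec_zero, neg_zero]
    exact ⟨Submodule.mem_top, (Submodule.mem_bot K).2 rfl⟩

/-- **`J_𝕋⁻¹ (0 × Y) = X × 0`**. [cite: Weil1964, n° 6, p. 151] [cite: MoeglinVignerasWaldspurger1987, Chap. 2 II.2] -/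
theorem map_transportSp_symJ_inv_prod_bot_top :
    Submodule.map ((((transportSp T hT (SymplecticGroup.symJ ι K))⁻¹ : symplecticGroup (polar (Matrix.toLinearMap₂' K T))) :
        ((ι → K) × (ι → K)) ≃ₗ[K] ((ι → K) × (ι → K))) : ((ι → K) × (ι → K)) →ₗ[K] ((ι → K) × (ι → K)))
        (Submodule.prod ⊥ ⊤) = Submodule.prod ⊤ ⊥ := by
  rw [← map_transportSp_symJ_prod_top_bot T hT, ← Submodule.map_comp, ← coe_mul_eq_comp, inv_mul_cancel, Subgroup.coe_one]
  exact Submodule.map_id _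

end Symplectic

/-! ## §2 The doubled unitary group: `ℓ_∇ = ι^𝔻(w_Δ) ℓ_Δ`, the X-row of a Cayley mover, and `∃ B, E′ ι^𝔻(h) E′⁻¹ = transportSp 𝕋 (m(B))` -/

section Doubled

variable (F : Type) [Field F] [NumberField F] (E : Type) [Field E] [NumberField E] [Algebra F E]
  [Algebra.IsQuadraticExtension F E] (c : E ≃ₐ[F] E)
  {δ : E} (hcδ : c δ = -δ) (hδ : δ ≠ 0) {d : F} (hd : δ * δ = algebraMap F E d)
  (v : HeightOneSpectrum (𝓞 F)) (n : ℕ) {T₀ : Matrix (Fin n) (Fin n) F} (hT₀ : T₀.IsSymm)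
  {JD : Matrix (Fin (n + n)) (Fin (n + n)) E} (hJD : JD = (gramD F n T₀).map (algebraMap F E))

/-- **`ι^𝔻(h)` FIXES `ℓ_∇ = ι^𝔻(w_Δ) ℓ_Δ` WHEN `B(h) = C(h) = 0`**: the block-diagonal (Siegel Levi) elements of `H(F_v)` stabilise the opposite
Lagrangian `Res Δ⁻ = ι^𝔻(w_Δ)(Res Δ)` (`w_Δ h w_Δ ∈ P_Δ`, ★ `isSiegelDelta_weylDelta_conj`, and `w_Δ² = 1`).
[cite: Kudla1994, §3 Thm. 3.1] [cite: HarrisKudlaSweet1996, §1 (1.11)] -/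
theorem map_map_iotaD_weylDelta_deltaLagrangian {h : UnitaryGroup.localPi E c (n + n) JD v}
    (hB : blkB (matA F E c v n h) = 0) (hC : blkC (matA F E c v n h) = 0) :
    ((deltaLagrangian F v n).map (toLin F v (iotaD F E c hcδ hδ hd v n hT₀ hJD (weylDelta F E c v n hJD)))).map
        (toLin F v (iotaD F E c hcδ hδ hd v n hT₀ hJD h)) =
      (deltaLagrangian F v n).map (toLin F v (iotaD F E c hcδ hδ hd v n hT₀ hJD (weylDelta F E c v n hJD))) := by
  have hS : (deltaLagrangian F v n).map
      (toLin F v (iotaD F E c hcδ hδ hd v n hT₀ hJD (weylDelta F E c v n hJD * h * weylDelta F E c v n hJD))) = deltaLagrangian F v n :=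
    isSiegelDelta_weylDelta_conj F E c hcδ hδ hd v n hT₀ hJD hC hB
  have hprod : h * weylDelta F E c v n hJD = weylDelta F E c v n hJD * (weylDelta F E c v n hJD * h * weylDelta F E c v n hJD) := by
    rw [← mul_assoc, ← mul_assoc, weylDelta_mul_self F E c v n hJD, one_mul]
  rw [← Submodule.map_comp, ← coe_mul_eq_comp, ← map_mul, hprod, map_mul, coe_mul_eq_comp, Submodule.map_comp, hS]

/-- **THE X-ROW OF A CAYLEY MOVER, DERIVED**: if `E′ ℓ_Δ = ℓ_Y` and `E′ · ι^𝔻(w_Δ) · E′⁻¹ = J_𝕋⁻¹ · m(B_W)` (the two rows ★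
`exists_mover_conj_iotaD_weylDelta` prints), then `E′ (ι^𝔻(w_Δ) ℓ_Δ) = J_𝕋⁻¹ m(B_W) ℓ_Y = X × 0` — the mover carries the opposite Lagrangian
`ℓ_∇` onto `X × 0`. [cite: Kudla1994, §2, §3 Thm. 3.1] [cite: Weil1964, n° 32] -/
theorem map_map_iotaD_weylDelta_deltaLagrangian_eq_prod (hTv : IsUnit (localGram F (n + n) (gramD F n T₀) v).det)
    (E' : LocalSp F (n + n) (gramD F n T₀) v)
    (hEY : (deltaLagrangian F v n).map (toLin F v E') = lagrangianY F (n + n) v)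
    (BW : GL (Fin (n + n)) (v.adicCompletion F))
    (hEW : E' * iotaD F E c hcδ hδ hd v n hT₀ hJD (weylDelta F E c v n hJD) * E'⁻¹ =
      (transportSp (localGram F (n + n) (gramD F n T₀) v) hTv (SymplecticGroup.symJ _ _))⁻¹ *
        transportSp (localGram F (n + n) (gramD F n T₀) v) hTv (levi BW)) :
    ((deltaLagrangian F v n).map (toLin F v (iotaD F E c hcδ hδ hd v n hT₀ hJD (weylDelta F E c v n hJD)))).map (toLin F v E') =
      Submodule.prod ⊤ ⊥ := by
  have hprod : E' * iotaD F E c hcδ hδ hd v n hT₀ hJD (weylDelta F E c v n hJD) =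
      (transportSp (localGram F (n + n) (gramD F n T₀) v) hTv (SymplecticGroup.symJ _ _))⁻¹ *
        transportSp (localGram F (n + n) (gramD F n T₀) v) hTv (levi BW) * E' := by
    rw [← hEW, inv_mul_cancel_right]
  rw [← Submodule.map_comp, ← coe_mul_eq_comp, hprod, coe_mul_eq_comp, Submodule.map_comp, hEY, lagrangianY, coe_mul_eq_comp,
    Submodule.map_comp, map_transportSp_levi_prod_bot_top, map_transportSp_symJ_inv_prod_bot_top]

/-- **THE LEVI DISCHARGE (doubled unitary currency)**: for `h ∈ H(F_v)` with block-diagonal adapted matrix (`B(h) = C(h) = 0`: `h` stabilises `ℓ_Δ`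
and `ℓ_∇`) and a mover `E′ ∈ Sp(𝕎^𝔻_v)` with the two Cayley rows `E′ ℓ_Δ = ℓ_Y`, `E′ · ι^𝔻(w_Δ) · E′⁻¹ = J_𝕋⁻¹ · m(B_W)`, the conjugate
`E′ · ι^𝔻(h) · E′⁻¹` fixes `0 × Y` and `X × 0`, hence **`= transportSp 𝕋 (m(B))` for some `B ∈ GL_{n+n}(F_v)`**.
[cite: Kudla1994, §3 Thm. 3.1] [cite: HarrisKudlaSweet1996, §1 (1.11), (1.15)] [cite: MoeglinVignerasWaldspurger1987, Chap. 2 II.2, II.6] -/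
theorem exists_conj_iotaD_eq_transportSp_levi (hTv : IsUnit (localGram F (n + n) (gramD F n T₀) v).det)
    (E' : LocalSp F (n + n) (gramD F n T₀) v)
    (hEY : (deltaLagrangian F v n).map (toLin F v E') = lagrangianY F (n + n) v)
    (BW : GL (Fin (n + n)) (v.adicCompletion F))
    (hEW : E' * iotaD F E c hcδ hδ hd v n hT₀ hJD (weylDelta F E c v n hJD) * E'⁻¹ =
      (transportSp (localGram F (n + n) (gramD F n T₀) v) hTv (SymplecticGroup.symJ _ _))⁻¹ *
        transportSp (localGram F (n + n) (gramD F n T₀) v) hTv (levi BW))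
    {h : UnitaryGroup.localPi E c (n + n) JD v} (hB : blkB (matA F E c v n h) = 0) (hC : blkC (matA F E c v n h) = 0) :
    ∃ B : GL (Fin (n + n)) (v.adicCompletion F),
      E' * iotaD F E c hcδ hδ hd v n hT₀ hJD h * E'⁻¹ = transportSp (localGram F (n + n) (gramD F n T₀) v) hTv (levi B) := by
  have hS : (deltaLagrangian F v n).map (toLin F v (iotaD F E c hcδ hδ hd v n hT₀ hJD h)) = deltaLagrangian F v n :=
    (isSiegelDelta_iff_blkC_eq_zero F E c hcδ hδ hd v n hT₀ hJD h).2 hC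
  have hX := map_map_iotaD_weylDelta_deltaLagrangian_eq_prod F E c hcδ hδ hd v n hT₀ hJD hTv E' hEY BW hEW
  have hprod : E' * iotaD F E c hcδ hδ hd v n hT₀ hJD h * E'⁻¹ * E' = E' * iotaD F E c hcδ hδ hd v n hT₀ hJD h := inv_mul_cancel_right _ _
  refine exists_eq_transportSp_levi_of_map_le _ hTv _ (le_of_eq ?_) (le_of_eq ?_)
  · -- `X × 0 = E′ (ι(w_Δ) ℓ_Δ)` is fixed
    rw [← hX, ← Submodule.map_comp, ← coe_mul_eq_comp, hprod, coe_mul_eq_comp, Submodule.map_comp,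
      map_map_iotaD_weylDelta_deltaLagrangian F E c hcδ hδ hd v n hT₀ hJD hB hC]
  · -- `0 × Y = ℓ_Y = E′ ℓ_Δ` is fixed
    rw [show (Submodule.prod ⊥ ⊤ : Submodule (v.adicCompletion F) ((Fin (n + n) → v.adicCompletion F) × (Fin (n + n) → v.adicCompletion F))) =
        lagrangianY F (n + n) v from rfl, ← hEY, ← Submodule.map_comp, ← coe_mul_eq_comp, hprod, coe_mul_eq_comp, Submodule.map_comp, hS]

end Doubled

/-! ## §3 The K2Lit tensor currency: `h := k ⊗ 1 = tensorEmbLoc v k` for `k ∈ M_Δ = leviDeltaLoc` -/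

section Tensor

open Literature.NumberTheory.GelbartRogawski1991.GRConstruction Literature.NumberTheory.K2Lit.SiegelDoubled
open Summit.HodgeConjecture.HodgeConjecture.Cruxes.HLiu418.K2LiuLocalSWSectionDefs
open Summit.HodgeConjecture.HodgeConjecture.Cruxes.HLiu418.K2LiuLocalSWTensorAdaptedBlocks
open Summit.HodgeConjecture.HodgeConjecture.Cruxes.HLiu418.K2LiuA7ValuePartnerBlocks
open Summit.HodgeConjecture.HodgeConjecture.Cruxes.HLiu418.K2LiuA7ValueInstanceDefs

variable (L : Type) [Field L] [NumberField L] [IsCMField L]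
variable {N M n : ℕ} (e : Fin N × Fin M ≃ Fin n)
  (dV : Fin N → L) (hdV : ∀ i, IsCMField.complexConj L (dV i) = dV i)
  (dW : Fin M → L) (hdW : ∀ i, IsCMField.complexConj L (dW i) = dW i)
variable {M₂ M' n' : ℕ} (eW : Fin M × Fin M₂ ≃ Fin M') (e' : Fin N × Fin M' ≃ Fin n')
  (dV' : Fin M₂ → L) (hdV' : ∀ k, IsCMField.complexConj L (dV' k) = dV' k)
variable (v : HeightOneSpectrum (𝓞 (Fp L)))

/-- **(C3-b) THE LEVI DISCHARGE FOR `k ∈ M_Δ` (K2Liu-p26's `hB` letters)**: for the big doubled datum `𝔻 ⊗ V′` (Gram `gramR L e′ …`), a mover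
`E′ ∈ Sp(𝕎_v)` with the two Cayley rows `E′ ℓ_Δ = ℓ_Y` and `E′ · ι^𝔻(w_Δ) · E′⁻¹ = J_𝕋⁻¹ · m(B_W)` (at use:
`E′ := π(frameMp_{PD} j̃(p₁, p₂))`, rows from (C2c)), and `k` in the Siegel LEVI `M_Δ = leviDeltaLoc` of the SMALL group `U(𝔻)(L⁺_v)`:
**`∃ B, E′ · ι^𝔻(k ⊗ 1) · E′⁻¹ = transportSp 𝕋 (m(B))`** (`k ⊗ 1 = tensorEmbLoc v k` is again block-diagonal, ★ `blkB∕blkC_matA_tensorEmbLoc_eq_zero`).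
[cite: Kudla1994, §3 Thm. 3.1] [cite: HarrisKudlaSweet1996, §1 (1.11), (1.15)] [cite: MoeglinVignerasWaldspurger1987, Chap. 2 II.2, II.6] -/
theorem exists_conj_iotaD_tensorEmbLoc_eq_transportSp_levi
    (hTv : IsUnit (localGram (Fp L) (n' + n')
      (gramD (Fp L) n' (gramR L e' dV hdV (tensorFrame L dW eW dV') (tensorFrame_real L dW hdW eW dV' hdV'))) v).det)
    (E' : LocalSp (Fp L) (n' + n') (gramD (Fp L) n' (gramR L e' dV hdV (tensorFrame L dW eW dV') (tensorFrame_real L dW hdW eW dV' hdV'))) v)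
    (hEY : (deltaLagrangian (Fp L) v n').map (toLin (Fp L) v E') = lagrangianY (Fp L) (n' + n') v)
    (BW : GL (Fin (n' + n')) (v.adicCompletion (Fp L)))
    (hEW : haveI : Algebra.IsQuadraticExtension (Fp L) L := IsCMField.isQuadraticExtension L
      E' * iotaD (Fp L) L (IsCMField.complexConj L) (complexConj_imagUnit L) (imagUnit_ne_zero L) (imagUnit_mul_self L) v n'
          (gramR_isSymm L e' dV hdV (tensorFrame L dW eW dV') (tensorFrame_real L dW hdW eW dV' hdV'))
          (hermD_eq_map_gramD L e' dV hdV (tensorFrame L dW eW dV') (tensorFrame_real L dW hdW eW dV' hdV'))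
          (weylDelta (Fp L) L (IsCMField.complexConj L) v n'
            (hermD_eq_map_gramD L e' dV hdV (tensorFrame L dW eW dV') (tensorFrame_real L dW hdW eW dV' hdV'))) * E'⁻¹ =
        (transportSp (localGram (Fp L) (n' + n')
            (gramD (Fp L) n' (gramR L e' dV hdV (tensorFrame L dW eW dV') (tensorFrame_real L dW hdW eW dV' hdV'))) v) hTv
            (SymplecticGroup.symJ _ _))⁻¹ *
          transportSp (localGram (Fp L) (n' + n')
            (gramD (Fp L) n' (gramR L e' dV hdV (tensorFrame L dW eW dV') (tensorFrame_real L dW hdW eW dV' hdV'))) v) hTv (levi BW))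
    {k : UnitaryGroup.localPi L (IsCMField.complexConj L) (n + n) (hermD L e dV hdV dW hdW) v} (hk : k ∈ leviDeltaLoc L e dV hdV dW hdW v) :
    haveI : Algebra.IsQuadraticExtension (Fp L) L := IsCMField.isQuadraticExtension L
    ∃ B : GL (Fin (n' + n')) (v.adicCompletion (Fp L)),
      E' * iotaD (Fp L) L (IsCMField.complexConj L) (complexConj_imagUnit L) (imagUnit_ne_zero L) (imagUnit_mul_self L) v n'
          (gramR_isSymm L e' dV hdV (tensorFrame L dW eW dV') (tensorFrame_real L dW hdW eW dV' hdV'))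
          (hermD_eq_map_gramD L e' dV hdV (tensorFrame L dW eW dV') (tensorFrame_real L dW hdW eW dV' hdV'))
          (tensorEmbLoc L e dV hdV dW hdW eW e' dV' hdV' v k) * E'⁻¹ =
        transportSp (localGram (Fp L) (n' + n')
          (gramD (Fp L) n' (gramR L e' dV hdV (tensorFrame L dW eW dV') (tensorFrame_real L dW hdW eW dV' hdV'))) v) hTv (levi B) := by
  haveI : Algebra.IsQuadraticExtension (Fp L) L := IsCMField.isQuadraticExtension L
  exact exists_conj_iotaD_eq_transportSp_levi (Fp L) L (IsCMField.complexConj L) (complexConj_imagUnit L) (imagUnit_ne_zero L)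
    (imagUnit_mul_self L) v n' (gramR_isSymm L e' dV hdV (tensorFrame L dW eW dV') (tensorFrame_real L dW hdW eW dV' hdV'))
    (hermD_eq_map_gramD L e' dV hdV (tensorFrame L dW eW dV') (tensorFrame_real L dW hdW eW dV' hdV')) hTv E' hEY BW hEW
    (blkB_matA_tensorEmbLoc_eq_zero L e dV hdV dW hdW eW e' dV' hdV' v ((mem_leviDeltaLoc_iff L e dV hdV dW hdW v k).1 hk).1)
    (blkC_matA_tensorEmbLoc_eq_zero L e dV hdV dW hdW eW e' dV' hdV' v ((mem_leviDeltaLoc_iff L e dV hdV dW hdW v k).1 hk).2)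

end Tensor

end Summit.HodgeConjecture.HodgeConjecture.Cruxes.HLiu418.K2LiuSymplecticLeviOfFixedLagrangians

end
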